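import Literature.NumberTheory.Automorphic.UnitaryGroupLocalCongr
import Literature.NumberTheory.Automorphic.UnitaryGroupFinAdelicCenterLocal
import Literature.RepresentationTheory.TwistedCoinvariants
import HarnessLib

/-!
# A rational similitude `g ↦ B g B⁻¹` and the `χ`-coinvariants under the centre: `π_χ ∘ Ad(B)` is the `χ`-coinvariant representation of `ω ∘ Ad(B)`

Topic `NumberTheory/GelbartRogawski1991`; namespaces `Literature.NumberTheory.Automorphic.UnitaryGroup` (§1: ★ `localCongr`, `localCenter`) and
`Literature.RepresentationTheory.TwistedCoinv` (§2).  KERNEL ONLY: theorems; no definition, no named fact, no `sorry`.  Cell `hodgecm-mathlib` (D-0151),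
programme P5 (crux HLiu418 = stmt-HodgeConjecture-24832), stone **L4-Ad** of the road card `F0/P5/A-p18/g23/ROAD-L4if-v2.A-p18g23.md` (step (M3), representation
level; the `Ad`-twin of ★ L4 `LocalGaloisConjCoinvariants`): for a theta-type representation `π = (ω)_{Z,χ}` — the `χ`-coinvariants of a representation `ω`
of `U(J)(F_v)` under its centre `Z = U(J₁)(F_v)` ([Liu2021, App. D §D.1 Step 3]: «the maximal quotient on which the centre acts by `χ`») — and the local
congruence `κ = Ad(B_v) : U(J′)(F_v) ≃ U(J)(F_v)` of a rational similitude `ᵗ(cB)(a•J)B = J′` ([PlatonovRapinchuk1994, §2.3]; ★ `localCongr`):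
* §1 `localCongr_localCenter`: `B (u·1_N) B⁻¹ = u·1_N` — `Ad(B)` FIXES the centre pointwise;
* §2 `ker_comp_localCongr_eq` (the relation submodules of `ω ∘ κ` and `ω` for the SAME `χ` coincide), and **`rep_comp_localCongr_apply`**: on the common quotient
  (`Submodule.quotEquivOfEq`, the identity on classes) `rep χ (ω ∘ κ)` acts as `g ↦ rep χ ω (κ g)` — i.e. **`π_χ(ω ∘ Ad B) = π_χ(ω) ∘ Ad B`** with the same
  central character (contrast ★ L4: `bar` inverts it).
Nothing of the cited sources is asserted; HC_CM is proved only modulo the printed citations until rung 0 closes.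

## References
* [MoeglinVignerasWaldspurger1987] LNM 1291 (1987), Chap. 2 II.2; Chap. 3 IV.
* [Liu2021] Y. Liu, App. D §D.1 Step 3 (l. 5221).
* [PlatonovRapinchuk1994] V. Platonov, A. Rapinchuk, Algebraic Groups and Number Theory (1994), §2.3.
-/

set_option autoImplicit false

noncomputable section

open NumberField IsDedekindDomain Matrix

namespace Literature.NumberTheory.Automorphic.UnitaryGroup

variable {F : Type} (E : Type) [Field F] [NumberField F] [Field E] [NumberField E] [Algebra F E]
variable (c : E ≃ₐ[F] E) {N : ℕ} (B : GL (Fin N) E) {a : E} (ha : a ≠ 0) {J J' : Matrix (Fin N) (Fin N) E}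
  (h : formCongr (c : E →+* E) B (a • J) = J') {J₁ : Matrix (Fin 1) (Fin 1) E} (hJ₁0 : J₁ 0 0 ≠ 0) (v : HeightOneSpectrum (𝓞 F))

/-! ## §1 `Ad(B)` fixes the centre pointwise -/

/-- **`B_v (u · 1_N) B_v⁻¹ = u · 1_N`**: the local congruence of a rational similitude fixes the centre `Z = U(J₁)(F_v)` pointwise (scalar matrices are central).
[cite: PlatonovRapinchuk1994, §2.3] [cite: MoeglinVignerasWaldspurger1987, Chap. 2 II.2] -/
theorem localCongr_localCenter (u : localPi E c 1 J₁ v) :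
    localCongr E c B ha h v (localCenter E c N J' J₁ hJ₁0 v u) = localCenter E c N J J₁ hJ₁0 v u := by
  refine Subtype.ext (funext fun w => Units.ext ?_)
  rw [coe_localCongr_apply_apply, coe_localCenter, coe_localCenter, Units.val_mul, Units.val_mul, coe_localScalarGL_apply, Matrix.mul_smul,
    Matrix.mul_one, Matrix.smul_mul, ← Units.val_mul, mul_inv_cancel, Units.val_one]

end Literature.NumberTheory.Automorphic.UnitaryGroup

/-! ## §2 The coinvariants of `ω ∘ Ad(B)` -/

namespace Literature.RepresentationTheory.TwistedCoinv

open Literature.NumberTheory.Automorphic Literature.NumberTheory.Automorphic.UnitaryGroup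

variable {F : Type} {E : Type} [Field F] [NumberField F] [Field E] [NumberField E] [Algebra F E]
  {c : E ≃ₐ[F] E} {N : ℕ} (B : GL (Fin N) E) {a : E} (ha : a ≠ 0) {J J' : Matrix (Fin N) (Fin N) E}
  (h : formCongr (c : E →+* E) B (a • J) = J') {J₁ : Matrix (Fin 1) (Fin 1) E} (hJ₁0 : J₁ 0 0 ≠ 0) {v : HeightOneSpectrum (𝓞 F)}
  {S : Type*} [AddCommGroup S] [Module ℂ S]

/-- `ω ∘ κ` restricted to the centre IS `ω` restricted to the centre. [cite: MoeglinVignerasWaldspurger1987, Chap. 2 II.2] -/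
theorem comp_localCongr_comp_localCenter (ω : Representation ℂ (localPi E c N J v) S) :
    (ω.comp (localCongr E c B ha h v : localPi E c N J' v →* localPi E c N J v)).comp (localCenter E c N J' J₁ hJ₁0 v) =
      ω.comp (localCenter E c N J J₁ hJ₁0 v) :=
  MonoidHom.ext fun u => by
    rw [MonoidHom.comp_apply, MonoidHom.comp_apply, MonoidHom.comp_apply, MonoidHom.coe_coe, localCongr_localCenter]

/-- A representation of `U(J)(F_v)` commuting with its centre still commutes after composing with `κ`. [cite: MoeglinVignerasWaldspurger1987, Chap. 2 II.2] -/
theorem commute_comp_localCongr (ω : Representation ℂ (localPi E c N J v) S) (g : localPi E c N J' v) (u : localPi E c 1 J₁ v) :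
    Commute ((ω.comp (localCongr E c B ha h v : localPi E c N J' v →* localPi E c N J v)) g)
      (((ω.comp (localCongr E c B ha h v : localPi E c N J' v →* localPi E c N J v)).comp (localCenter E c N J' J₁ hJ₁0 v)) u) := by
  rw [comp_localCongr_comp_localCenter]
  simp only [MonoidHom.comp_apply, MonoidHom.coe_coe]
  refine Commute.map ?_ ω
  rw [← localCongr_localCenter E c B ha h hJ₁0 v u]
  refine Commute.map ?_ (localCongr E c B ha h v)
  exact localCenter_comm E c N J' J₁ hJ₁0 v u g

/-- **The relation submodules agree**: `span {ω(κ(u·1)) x − χ(u) x} = span {ω(u·1) x − χ(u) x}`. [cite: MoeglinVignerasWaldspurger1987, Chap. 2 II.2]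
[cite: Liu2021, App. D §D.1 Step 3 (l. 5221)] -/
theorem ker_comp_localCongr_eq (ω : Representation ℂ (localPi E c N J v) S) (χ : localPi E c 1 J₁ v →* ℂˣ) :
    ker ((ω.comp (localCongr E c B ha h v : localPi E c N J' v →* localPi E c N J v)).comp (localCenter E c N J' J₁ hJ₁0 v)) χ =
      ker (ω.comp (localCenter E c N J J₁ hJ₁0 v)) χ := by
  rw [comp_localCongr_comp_localCenter]

/-- **`π_χ ∘ Ad(B)` IS the coinvariant representation of `ω ∘ Ad(B)` for the SAME `χ`**: on the common quotient (`Submodule.quotEquivOfEq` along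
`ker_comp_localCongr_eq`, the identity on classes) `rep χ (ω ∘ κ)` acts as `g ↦ rep χ ω (κ g)`.
[cite: MoeglinVignerasWaldspurger1987, Chap. 2 II.2] [cite: Liu2021, App. D §D.1 Step 3 (l. 5221)] -/
theorem rep_comp_localCongr_apply (ω : Representation ℂ (localPi E c N J v) S) (χ : localPi E c 1 J₁ v →* ℂˣ)
    (hc : ∀ (g : localPi E c N J v) (u : localPi E c 1 J₁ v), Commute (ω g) ((ω.comp (localCenter E c N J J₁ hJ₁0 v)) u))
    (g : localPi E c N J' v)
    (x : Coinv ((ω.comp (localCongr E c B ha h v : localPi E c N J' v →* localPi E c N J v)).comp (localCenter E c N J' J₁ hJ₁0 v)) χ) :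
    Submodule.quotEquivOfEq _ _ (ker_comp_localCongr_eq B ha h hJ₁0 ω χ)
        (rep χ (ω.comp (localCongr E c B ha h v : localPi E c N J' v →* localPi E c N J v)) (commute_comp_localCongr B ha h hJ₁0 ω) g x) =
      rep χ ω hc (localCongr E c B ha h v g) (Submodule.quotEquivOfEq _ _ (ker_comp_localCongr_eq B ha h hJ₁0 ω χ) x) := by
  obtain ⟨y, rfl⟩ := mk_surjective _ _ x
  rfl

end Literature.RepresentationTheory.TwistedCoinv

end
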